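import Literature.Analysis.UnboundedOperators.LinearizedBoltzmannPolynomialInverse
import Literature.Analysis.UnboundedOperators.LinearizedBoltzmannPositivityProofs
import HarnessLib

/-!
# The Chapman–Enskog pre-image of QUADRATIC data, uniformly in the support radius
# (helper `t12_quarticPreimage_of_quadraticData` of the line `birth`, crux `TwoClocks.EquilibriumFastWindowLD`,
# stmt-AtomisticToContinuum-14440; first lemma towards the analytic residue T1 of `stub_correctorTransfer`)

The corrector transfer of the line `birth` inverts the linearised hard-sphere operator `L` of `ℝ³`
(`Literature.Analysis.UnboundedOperators.hardSphereLinearizedOp`, `M`-weighted picture, CIP 1994 §7.2) on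
observables `g` of the bounded class `𝒢(C')`: continuous, **`|g(v)| ≤ C_g (1 + |v|²)`**, compact velocity
support, `M`-orthogonal to `1, v_j, |v|²`. The tree's polynomial inverse
(`exists_continuous_inverse_hardSphereLinearizedOp_quartic`) is stated for BOUNDED data `|g| ≤ b` and gives
`|ψ₀(v)| ≤ C b (1 + |v|²)²`; applied to `g ∈ 𝒢(C')` with support radius `R` it yields the `R`-DEPENDENT
constant `b = C_g (1 + R²)`. Here we remove this dependence:

* `abs_le_mul_quartic_of_fixedPoint_quadratic` — a-priori estimate: a solution `ψ` of Grad's integral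
  equation `ν ψ = K ψ - g` with SOME Gaussian a-priori bound `|ψ| ≤ A e^{|v|²/4}`, `‖ψ‖_{L²(M)} ≤ B` and
  quadratic data `|g(v)| ≤ C_g (1 + |v|²)` satisfies `|ψ(v)| ≤ C (B + C_g) (1 + |v|²)²` with an ABSOLUTE `C`
  — the a-priori constant `A` does NOT enter (on the bounded ball the tree used `A`; we use instead the
  Gaussian growth of the kernel action of an `L²(M)` function, `exists_abs_kernelAction_le_exp`, and off the
  ball the absorption step `abs_le_threeQuarter_weight_add_of_fixedPoint` with the POINTWISE data bound
  `b = C_g (1 + |y|²) ≤ C_g W(y)`);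
* `t12_quarticPreimage_of_quadraticData` (registered helper) — for every continuous `g` with
  `|g| ≤ C_g (1 + |v|²)`, support in a ball, `⊥_M` the collision invariants, the `M`-orthogonal pre-image
  `ψ₀` (`L ψ₀ = g` everywhere, `ψ₀ ∈ L²(M)`, `ψ₀ ⊥_M` invariants, continuous) obeys
  **`|ψ₀(v)| ≤ C · C_g · (1 + |v|²)²` with `C` absolute — independent of the support radius** (the `L²`
  norm of `g` is bounded by `C_g ‖1 + |·|²‖_{L²(M)}`, support-free, and the spectral gap bounds `B`).

This is the support-uniform a-priori input of the finer (sector-by-sector) analysis of the corrector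
(T1: log-linear growth; T2: radial log-modulus of the `ℓ = 1` profiles), which must start from SOME
polynomial bound uniform in `R`. The exponent `2` of `(1 + |v|²)` is that of the tree's radial
supersolution scheme (any exponent `> 1` works, none `≤ 1` does: `λ₀(α) = 4/(α+2) < 1 ⇔ α > 2`).

References: Grad 1963 §4; Caflisch 1980 (CMP 74) §2; Guo 2010 (ARMA 197) §3; CIP 1994 §7.2.
-/

noncomputable section

open MeasureTheory ProbabilityTheory Real Set Filter Metric
open scoped ENNReal BigOperators InnerProductSpace

namespace Summit.AtomisticToContinuum.HydrodynamicLimit.Theorems.ClampedCorrectorBirth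

open Literature.Analysis.FluidPDE Literature.MathematicalPhysics.KineticTheory
open Literature.Analysis.UnboundedOperators

/-- `1 + |·|²` is in `L²(M dv)` (Gaussian fourth moment). -/
theorem memLp_two_one_add_norm_sq :
    MemLp (fun v : EuclideanSpace ℝ (Fin 3) => 1 + ‖v‖ ^ 2) 2 (stdGaussian (EuclideanSpace ℝ (Fin 3))) := by
  have hmeas : AEStronglyMeasurable (fun v : EuclideanSpace ℝ (Fin 3) => 1 + ‖v‖ ^ 2)
      (stdGaussian (EuclideanSpace ℝ (Fin 3))) := by fun_prop
  rw [memLp_two_iff_integrable_sq hmeas]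
  refine (integrable_one_add_norm_pow_stdGaussian (E := EuclideanSpace ℝ (Fin 3)) 4).mono' (by fun_prop)
    (Eventually.of_forall fun v => ?_)
  rw [Real.norm_of_nonneg (sq_nonneg _)]
  nlinarith [norm_nonneg v, sq_nonneg ‖v‖, mul_nonneg (norm_nonneg v) (sq_nonneg ‖v‖)]

/-- The `L²(M)` norm of quadratic data is support-free: `|g| ≤ C_g (1 + |v|²)` implies
`‖g‖_{L²(M)} ≤ C_g ‖1 + |·|²‖_{L²(M)}`. -/
theorem eLpNorm_toReal_le_of_abs_le_quadratic {g : EuclideanSpace ℝ (Fin 3) → ℝ} {Cg : ℝ} (hCg : 0 ≤ Cg)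
    (hg : ∀ v, |g v| ≤ Cg * (1 + ‖v‖ ^ 2)) :
    (eLpNorm g 2 (stdGaussian (EuclideanSpace ℝ (Fin 3)))).toReal ≤
      Cg * (eLpNorm (fun v : EuclideanSpace ℝ (Fin 3) => 1 + ‖v‖ ^ 2) 2
        (stdGaussian (EuclideanSpace ℝ (Fin 3)))).toReal := by
  have h1 : eLpNorm g 2 (stdGaussian (EuclideanSpace ℝ (Fin 3))) ≤
      eLpNorm (Cg • fun v : EuclideanSpace ℝ (Fin 3) => 1 + ‖v‖ ^ 2) 2 (stdGaussian (EuclideanSpace ℝ (Fin 3))) :=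
    eLpNorm_mono_real fun v => by
      rw [Real.norm_eq_abs, Pi.smul_apply, smul_eq_mul]
      exact hg v
  rw [eLpNorm_const_smul, Real.enorm_eq_ofReal hCg] at h1
  have h2 := ENNReal.toReal_mono (ENNReal.mul_ne_top ENNReal.ofReal_ne_top memLp_two_one_add_norm_sq.eLpNorm_ne_top) h1
  rwa [ENNReal.toReal_mul, ENNReal.toReal_ofReal hCg] at h2

/-- The pointwise bound on a BALL, free of any a-priori growth constant: if `ν ψ = K ψ - g` at `y`,
`|K ψ (y)| ≤ K_x ‖ψ‖_{L²(M)} e^{|y|²/4}` (the Gaussian growth of the kernel action of an `L²(M)` function),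
`‖ψ‖_{L²(M)} ≤ B`, `|g(y)| ≤ C_g (1 + |y|²)`, `ν ≥ ν₀ > 0` and `|y| < R₀`, then
`|ψ(y)| ≤ (K_x B e^{R₀²/4} + C_g (1 + R₀²)) / ν₀`. -/
theorem abs_le_of_fixedPoint_of_norm_lt {ψ g : EuclideanSpace ℝ (Fin 3) → ℝ} {Kx B Cg ν₀ R₀ : ℝ}
    {y : EuclideanSpace ℝ (Fin 3)} (hKx0 : 0 ≤ Kx) (hB0 : 0 ≤ B) (hCg0 : 0 ≤ Cg) (hν₀ : 0 < ν₀)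
    (hνy : ν₀ ≤ collisionFrequency y) (hy : ‖y‖ < R₀)
    (hB : (eLpNorm ψ 2 (stdGaussian (EuclideanSpace ℝ (Fin 3)))).toReal ≤ B)
    (hgb : |g y| ≤ Cg * (1 + ‖y‖ ^ 2))
    (hKy : |∫ w, ∫ ω, hardSphereKernel (y, w) ω * (ψ (collide ω (y, w)).1 + ψ (collide ω (y, w)).2 - ψ w)
        ∂sphereMeasure ∂stdGaussian (EuclideanSpace ℝ (Fin 3))| ≤
      Kx * (eLpNorm ψ 2 (stdGaussian (EuclideanSpace ℝ (Fin 3)))).toReal * Real.exp (‖y‖ ^ 2 / 4))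
    (hfix : collisionFrequency y * ψ y =
      (∫ w, ∫ ω, hardSphereKernel (y, w) ω * (ψ (collide ω (y, w)).1 + ψ (collide ω (y, w)).2 - ψ w)
        ∂sphereMeasure ∂stdGaussian (EuclideanSpace ℝ (Fin 3))) - g y) :
    |ψ y| ≤ (Kx * B * Real.exp (R₀ ^ 2 / 4) + Cg * (1 + R₀ ^ 2)) / ν₀ := by
  have hν : 0 < collisionFrequency y := hν₀.trans_le hνy
  set Kψ := ∫ w, ∫ ω, hardSphereKernel (y, w) ω * (ψ (collide ω (y, w)).1 + ψ (collide ω (y, w)).2 - ψ w)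
    ∂sphereMeasure ∂stdGaussian (EuclideanSpace ℝ (Fin 3)) with hKψdef
  have hyR : ‖y‖ ^ 2 ≤ R₀ ^ 2 := pow_le_pow_left₀ (norm_nonneg y) hy.le 2
  have h1 : |ψ y| * collisionFrequency y ≤ |Kψ| + |g y| := by
    have : ψ y * collisionFrequency y = Kψ - g y := by rw [mul_comm]; exact hfix
    rw [← abs_of_pos hν, ← abs_mul, this]
    exact abs_sub _ _
  have h2 : |Kψ| ≤ Kx * B * Real.exp (R₀ ^ 2 / 4) := by
    have he : Real.exp (‖y‖ ^ 2 / 4) ≤ Real.exp (R₀ ^ 2 / 4) := Real.exp_le_exp.2 (by linarith only [hyR])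
    exact hKy.trans (mul_le_mul (mul_le_mul_of_nonneg_left hB hKx0) he (Real.exp_nonneg _) (mul_nonneg hKx0 hB0))
  have h3 : |g y| ≤ Cg * (1 + R₀ ^ 2) := hgb.trans (mul_le_mul_of_nonneg_left (by linarith only [hyR]) hCg0)
  have h4 : |ψ y| * collisionFrequency y ≤
      (Kx * B * Real.exp (R₀ ^ 2 / 4) + Cg * (1 + R₀ ^ 2)) / ν₀ * collisionFrequency y := by
    have h5 : Kx * B * Real.exp (R₀ ^ 2 / 4) + Cg * (1 + R₀ ^ 2) ≤
        (Kx * B * Real.exp (R₀ ^ 2 / 4) + Cg * (1 + R₀ ^ 2)) / ν₀ * collisionFrequency y := by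
      rw [div_mul_eq_mul_div, le_div_iff₀ hν₀]
      exact mul_le_mul_of_nonneg_left hνy (by positivity)
    linarith only [h1, h2, h3, h5]
  exact le_of_mul_le_mul_right h4 hν

/-- **A-priori quartic bound for Grad's integral equation with QUADRATIC data (`ℝ³`).** There is an
absolute constant `C` such that: if `ψ` is measurable with SOME Gaussian a-priori bound
`|ψ(x)| ≤ A e^{|x|²/4}`, `ψ ∈ L²(M dv)` with `‖ψ‖_{L²(M)} ≤ B`, the data satisfy `|g(v)| ≤ C_g (1 + |v|²)`, and
`ν ψ = ∫∫ B (ψ' + ψ_*' - ψ_*) dω dM_* - g` pointwise, then `|ψ(v)| ≤ C (B + C_g) (1 + |v|²)²` for every `v` —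
the a-priori constant `A` does not enter. Same truncated-weight absorption as the tree's
`exists_abs_le_mul_quartic_of_fixedPoint` (`W_N = max ((1+|·|²)², e^{|·|²/4}/N)`, `m_N ≤ (3/4) m_N + D`,
`N → ∞`), with two changes: on the ball `|y| < R₀` the kernel action is bounded through the `L²(M)` norm
(`exists_abs_kernelAction_le_exp`) instead of `A`, and off the ball the absorption lemma is fed the
pointwise data bound `b = C_g (1 + |y|²) ≤ C_g W(y)`. -/
theorem abs_le_mul_quartic_of_fixedPoint_quadratic :
    ∃ C : ℝ, 0 < C ∧ ∀ (ψ g : EuclideanSpace ℝ (Fin 3) → ℝ) (A B Cg : ℝ), Measurable ψ →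
      (∀ x, |ψ x| ≤ A * Real.exp (‖x‖ ^ 2 / 4)) →
      MemLp ψ 2 (stdGaussian (EuclideanSpace ℝ (Fin 3))) →
      (eLpNorm ψ 2 (stdGaussian (EuclideanSpace ℝ (Fin 3)))).toReal ≤ B →
      (∀ v, |g v| ≤ Cg * (1 + ‖v‖ ^ 2)) →
      (∀ v, collisionFrequency v * ψ v =
        (∫ w, ∫ ω, hardSphereKernel (v, w) ω * (ψ (collide ω (v, w)).1 + ψ (collide ω (v, w)).2 - ψ w)
          ∂sphereMeasure ∂stdGaussian (EuclideanSpace ℝ (Fin 3))) - g v) →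
      ∀ v, |ψ v| ≤ C * (B + Cg) * (1 + ‖v‖ ^ 2) ^ 2 := by
  -- the constants (as in the tree's quartic scheme, plus the `L² → pointwise` constant of the kernel action)
  obtain ⟨K4, hK40, hK4⟩ := exists_lintegral_gain_fst_gaussWeight_le (θ := 1 / 4) (by norm_num) (by norm_num)
  obtain ⟨ν₀, hν₀, hν₀le⟩ := exists_pos_le_collisionFrequency (E := EuclideanSpace ℝ (Fin 3)) (by simp)
  obtain ⟨Kx, hKx0, hKx⟩ := exists_abs_kernelAction_le_exp
  set S : ℝ := (sphereMeasure : Measure (sphere (0 : EuclideanSpace ℝ (Fin 3)) 1)).real univ with hS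
  have hS0 : 0 ≤ S := measureReal_nonneg
  set m₅ : ℝ := ∫ w, (1 + ‖w‖) ^ 5 ∂stdGaussian (EuclideanSpace ℝ (Fin 3)) with hm₅
  have hm₅0 : 0 ≤ m₅ := integral_nonneg fun w => by positivity
  set C₂ : ℝ := S * (((∫⁻ w, ENNReal.ofReal ((1 + ‖w‖) ^ 2) ∂stdGaussian (EuclideanSpace ℝ (Fin 3))) ^ (1 / 2 : ℝ)).toReal) *
      (1 / ν₀ + 1 / Real.pi) + 1 / ν₀ with hC₂
  have hC₂0 : 0 ≤ C₂ := by
    rw [hC₂]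
    exact add_nonneg (mul_nonneg (mul_nonneg hS0 ENNReal.toReal_nonneg)
      (add_nonneg (by positivity) (by positivity))) (by positivity)
  have hq1 : 0 ≤ 96 * (3 * S * m₅) / Real.pi :=
    div_nonneg (mul_nonneg (by norm_num) (mul_nonneg (mul_nonneg (by norm_num) hS0) hm₅0)) Real.pi_pos.le
  have hq2 : 0 ≤ 96 * K4 / Real.pi := div_nonneg (mul_nonneg (by norm_num) hK40) Real.pi_pos.le
  set R₀ : ℝ := 4 + 96 * (3 * S * m₅) / Real.pi + 96 * K4 / Real.pi + 1 with hR₀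
  have hR₀4 : 4 ≤ R₀ := by rw [hR₀]; linarith
  set E₀ : ℝ := Real.exp (R₀ ^ 2 / 4) with hE₀
  have hE₀1 : 1 ≤ E₀ := Real.one_le_exp (by positivity)
  -- the absolute constant: `D ≤ (C/4) (B + C_g)` below
  set C : ℝ := 4 * (C₂ + (Kx * E₀ + (1 + R₀ ^ 2)) / ν₀) + 1 with hCdef
  have hCpos : 0 < C := by
    rw [hCdef]
    have : 0 ≤ (Kx * E₀ + (1 + R₀ ^ 2)) / ν₀ := by positivity
    positivity
  refine ⟨C, hCpos, fun ψ g A B Cg hψm hψA hψ2 hB hgb hfix => ?_⟩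
  have hA0 : 0 ≤ A := by
    have h := hψA 0
    rw [norm_zero] at h
    norm_num at h
    exact (abs_nonneg _).trans h
  have hB0 : 0 ≤ B := ENNReal.toReal_nonneg.trans hB
  have hCg0 : 0 ≤ Cg := by
    have h := hgb 0
    rw [norm_zero] at h
    norm_num at h
    exact (abs_nonneg _).trans h
  -- the pointwise bound on the ball, free of `A`
  set Dball : ℝ := (Kx * B * E₀ + Cg * (1 + R₀ ^ 2)) / ν₀ with hDball
  have hDball0 : 0 ≤ Dball := by rw [hDball]; positivity
  have hball : ∀ y, ‖y‖ < R₀ → |ψ y| ≤ Dball := fun y hy =>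
    abs_le_of_fixedPoint_of_norm_lt hKx0 hB0 hCg0 hν₀ (hν₀le y) hy hB (hgb y) (hKx ψ hψm hψ2 y) (hfix y)
  set D : ℝ := C₂ * (B + Cg) + Dball with hD
  have hD0 : 0 ≤ D := by rw [hD]; exact add_nonneg (mul_nonneg hC₂0 (add_nonneg hB0 hCg0)) hDball0
  -- the estimate with the truncated weight, uniformly in `N`
  have key : ∀ N : ℝ, 0 < N → ∀ y,
      |ψ y| ≤ 4 * D * max ((1 + ‖y‖ ^ 2) ^ 2) (Real.exp ((1 / 4 : ℝ) * ‖y‖ ^ 2) / N) := by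
    intro N hN
    set W : EuclideanSpace ℝ (Fin 3) → ℝ := fun y =>
      max ((1 + ‖y‖ ^ 2) ^ 2) (Real.exp ((1 / 4 : ℝ) * ‖y‖ ^ 2) / N) with hW
    have hW1 : ∀ y, 1 ≤ W y := fun y => le_max_of_le_left (by nlinarith [norm_nonneg y])
    have hWP : ∀ y, 1 + ‖y‖ ^ 2 ≤ W y := fun y => le_max_of_le_left (by nlinarith [norm_nonneg y])
    have hWpos : ∀ y, 0 < W y := fun y => one_pos.trans_le (hW1 y)
    have hTb : BddAbove (Set.range fun y => |ψ y| / W y) := by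
      refine ⟨A * N, ?_⟩
      rintro _ ⟨y, rfl⟩
      rw [div_le_iff₀ (hWpos y)]
      have h4 : Real.exp (‖y‖ ^ 2 / 4) = N * (Real.exp ((1 / 4 : ℝ) * ‖y‖ ^ 2) / N) := by
        rw [show ‖y‖ ^ 2 / 4 = (1 / 4 : ℝ) * ‖y‖ ^ 2 by ring]; field_simp
      calc |ψ y| ≤ A * Real.exp (‖y‖ ^ 2 / 4) := hψA y
        _ = A * N * (Real.exp ((1 / 4 : ℝ) * ‖y‖ ^ 2) / N) := by rw [h4]; ring
        _ ≤ A * N * W y := mul_le_mul_of_nonneg_left (le_max_right _ _) (by positivity)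
    set m : ℝ := sSup (Set.range fun y => |ψ y| / W y) with hm
    have hle_m : ∀ y, |ψ y| / W y ≤ m := fun y => le_csSup hTb ⟨y, rfl⟩
    have hm0 : 0 ≤ m := (div_nonneg (abs_nonneg _) (hWpos 0).le).trans (hle_m 0)
    have hdom : ∀ y, |ψ y| ≤ m * W y := fun y => by
      have := hle_m y; rwa [div_le_iff₀ (hWpos y)] at this
    have himp : ∀ y, |ψ y| / W y ≤ 3 / 4 * m + D := by
      intro y
      rw [div_le_iff₀ (hWpos y)]
      rcases lt_or_ge ‖y‖ R₀ with hy | hy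
      · -- on the ball: the `L²`-based bound
        have h3 : Dball ≤ (3 / 4 * m + D) * W y := by
          have : Dball ≤ 3 / 4 * m + D := by
            have h0 : 0 ≤ C₂ * (B + Cg) := mul_nonneg hC₂0 (add_nonneg hB0 hCg0)
            rw [hD]; linarith only [h0, hm0]
          exact this.trans (le_mul_of_one_le_right (by positivity) (hW1 y))
        exact (hball y hy).trans h3
      · -- off the ball: absorption with the pointwise data bound `b = C_g (1 + |y|²)`
        have hy1 : 4 ≤ ‖y‖ := hR₀4.trans hy
        have hyn : 0 < ‖y‖ := by linarith
        have hy0 : y ≠ 0 := norm_pos_iff.1 hyn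
        have hy2 : 96 * (3 * S * m₅) ≤ Real.pi * ‖y‖ := by
          have : 96 * (3 * S * m₅) / Real.pi ≤ ‖y‖ := by
            rw [hR₀] at hy; linarith
          rwa [div_le_iff₀' Real.pi_pos] at this
        have hy3 : 96 * K4 ≤ Real.pi * ‖y‖ ^ 2 := by
          have h1 : 96 * K4 / Real.pi ≤ ‖y‖ := by
            rw [hR₀] at hy; linarith
          rw [div_le_iff₀' Real.pi_pos] at h1
          have : Real.pi * ‖y‖ ≤ Real.pi * ‖y‖ ^ 2 :=
            mul_le_mul_of_nonneg_left (le_self_pow₀ (by linarith only [hy1]) two_ne_zero) Real.pi_pos.le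
          linarith
        have hb0 : 0 ≤ Cg * (1 + ‖y‖ ^ 2) := by positivity
        have h := abs_le_threeQuarter_weight_add_of_fixedPoint hψm hψ2 hN hm0 hK40 hB0 hb0 hν₀ hdom hB hy1
          hy2 hy3 (hν₀le y) (hgb y) (hK4 y hy0) (hfix y)
        rw [← hS, ← hC₂] at h
        have hC₂W : C₂ * (B + Cg * (1 + ‖y‖ ^ 2)) ≤ D * W y := by
          have e1 : C₂ * B ≤ C₂ * B * W y :=
            le_mul_of_one_le_right (mul_nonneg hC₂0 hB0) (hW1 y)
          have e2 : C₂ * (Cg * (1 + ‖y‖ ^ 2)) ≤ C₂ * Cg * W y := by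
            rw [show C₂ * (Cg * (1 + ‖y‖ ^ 2)) = C₂ * Cg * (1 + ‖y‖ ^ 2) by ring]
            exact mul_le_mul_of_nonneg_left (hWP y) (mul_nonneg hC₂0 hCg0)
          have e3 : 0 ≤ Dball * W y := mul_nonneg hDball0 (hWpos y).le
          calc C₂ * (B + Cg * (1 + ‖y‖ ^ 2)) = C₂ * B + C₂ * (Cg * (1 + ‖y‖ ^ 2)) := by ring
            _ ≤ C₂ * B * W y + C₂ * Cg * W y + Dball * W y := by linarith
            _ = D * W y := by rw [hD]; ring
        calc |ψ y| ≤ 3 / 4 * m * W y + C₂ * (B + Cg * (1 + ‖y‖ ^ 2)) := h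
          _ ≤ 3 / 4 * m * W y + D * W y := add_le_add le_rfl hC₂W
          _ = (3 / 4 * m + D) * W y := by ring
    have hm_le : m ≤ 3 / 4 * m + D := csSup_le ⟨_, ⟨0, rfl⟩⟩ (by rintro _ ⟨y, rfl⟩; exact himp y)
    have hm2 : m ≤ 4 * D := by linarith
    intro y
    exact (hdom y).trans (mul_le_mul_of_nonneg_right hm2 (hWpos y).le)
  -- `N → ∞`, and `4 D ≤ C (B + C_g)`
  intro v
  have hN : 0 < Real.exp ((1 / 4 : ℝ) * ‖v‖ ^ 2) := Real.exp_pos _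
  have h := key _ hN v
  have h1 : (1 : ℝ) ≤ (1 + ‖v‖ ^ 2) ^ 2 := by nlinarith [norm_nonneg v]
  rw [div_self hN.ne', max_eq_left h1] at h
  refine h.trans (mul_le_mul_of_nonneg_right ?_ (by positivity))
  have hE₀0 : 0 ≤ E₀ := zero_le_one.trans hE₀1
  have hBC : 0 ≤ B + Cg := add_nonneg hB0 hCg0
  have e3 : Dball ≤ (Kx * E₀ + (1 + R₀ ^ 2)) / ν₀ * (B + Cg) := by
    rw [hDball, div_mul_eq_mul_div, div_le_div_iff_of_pos_right hν₀]
    have hx : (Kx * E₀ + (1 + R₀ ^ 2)) * (B + Cg) =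
        Kx * B * E₀ + Cg * (1 + R₀ ^ 2) + (Kx * E₀ * Cg + (1 + R₀ ^ 2) * B) := by ring
    have p1 : 0 ≤ Kx * E₀ * Cg := mul_nonneg (mul_nonneg hKx0 hE₀0) hCg0
    have p2 : 0 ≤ (1 + R₀ ^ 2) * B := mul_nonneg (by positivity) hB0
    linarith only [hx, p1, p2]
  have hDle : D ≤ (C₂ + (Kx * E₀ + (1 + R₀ ^ 2)) / ν₀) * (B + Cg) :=
    calc D = C₂ * (B + Cg) + Dball := hD
      _ ≤ C₂ * (B + Cg) + (Kx * E₀ + (1 + R₀ ^ 2)) / ν₀ * (B + Cg) := add_le_add le_rfl e3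
      _ = (C₂ + (Kx * E₀ + (1 + R₀ ^ 2)) / ν₀) * (B + Cg) := by ring
  calc 4 * D ≤ 4 * ((C₂ + (Kx * E₀ + (1 + R₀ ^ 2)) / ν₀) * (B + Cg)) := by linarith only [hDle]
    _ ≤ 4 * ((C₂ + (Kx * E₀ + (1 + R₀ ^ 2)) / ν₀) * (B + Cg)) + (B + Cg) := by linarith only [hBC]
    _ = C * (B + Cg) := by rw [hCdef]; ring

/-- **The Chapman–Enskog pre-image of quadratic data, uniformly in the support radius (`ℝ³`).**
There is an ABSOLUTE constant `C > 0` such that for every continuous `g` on `ℝ³` with the quadratic bound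
`|g(v)| ≤ C_g (1 + |v|²)`, supported in a ball `{|v| < R}`, and `M`-orthogonal to the collision invariants
`span {1, v, |v|²}`, the `M`-orthogonal pre-image `ψ₀` under the linearised hard-sphere operator
(`L ψ₀ = g` at every point; continuous; `ψ₀ ∈ L²(M dv)`; `ψ₀ ⊥_M` the invariants) satisfies
**`|ψ₀(v)| ≤ C · C_g · (1 + |v|²)²` for all `v`, with `C` independent of `g`, `C_g` and `R`.**
Existence and Gaussian a-priori growth from `exists_continuous_inverse_hardSphereLinearizedOp` (applied
with the `R`-dependent sup bound `C_g (1 + R²)`, which only serves finiteness), the support-free bound from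
`abs_le_mul_quartic_of_fixedPoint_quadratic` with `B = C_g ‖1 + |·|²‖_{L²(M)} / λ` (spectral gap). -/
theorem t12_quarticPreimage_of_quadraticData : ∃ C : ℝ, 0 < C ∧ ∀ (g : EuclideanSpace ℝ (Fin 3) → ℝ) (Cg R : ℝ), Continuous g → (∀ v, |g v| ≤ Cg * (1 + ‖v‖ ^ 2)) → (∀ v, R ≤ ‖v‖ → g v = 0) → (∀ φ ∈ Literature.Analysis.UnboundedOperators.collisionInvariants (EuclideanSpace ℝ (Fin 3)), Literature.Analysis.UnboundedOperators.maxwellianInner g φ = 0) → ∃ ψ₀ : EuclideanSpace ℝ (Fin 3) → ℝ, Continuous ψ₀ ∧ (∀ v, |ψ₀ v| ≤ C * Cg * (1 + ‖v‖ ^ 2) ^ 2) ∧ MeasureTheory.MemLp ψ₀ 2 (ProbabilityTheory.stdGaussian (EuclideanSpace ℝ (Fin 3))) ∧ (∀ φ ∈ Literature.Analysis.UnboundedOperators.collisionInvariants (EuclideanSpace ℝ (Fin 3)), Literature.Analysis.UnboundedOperators.maxwellianInner ψ₀ φ = 0) ∧ ∀ v, Literature.Analysis.UnboundedOperators.hardSphereLinearizedOp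 ψ₀ v = g v := by
  obtain ⟨lam, C₀, hlam, hC₀, hex⟩ := exists_continuous_inverse_hardSphereLinearizedOp
  obtain ⟨C, hC, hCb⟩ := abs_le_mul_quartic_of_fixedPoint_quadratic
  set M4 : ℝ := (eLpNorm (fun v : EuclideanSpace ℝ (Fin 3) => 1 + ‖v‖ ^ 2) 2
    (stdGaussian (EuclideanSpace ℝ (Fin 3)))).toReal with hM4
  have hM40 : 0 ≤ M4 := ENNReal.toReal_nonneg
  refine ⟨C * (M4 / lam + 1), by positivity, fun g Cg R hg hgb hsupp horth => ?_⟩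
  have hCg0 : 0 ≤ Cg := by
    have h := hgb 0
    rw [norm_zero] at h
    norm_num at h
    exact (abs_nonneg _).trans h
  -- the (R-dependent) sup bound, used only for existence and the a-priori Gaussian growth
  have hb : ∀ v, |g v| ≤ Cg * (1 + R ^ 2) := by
    intro v
    rcases lt_or_ge ‖v‖ R with hv | hv
    · refine (hgb v).trans (mul_le_mul_of_nonneg_left ?_ hCg0)
      have := pow_le_pow_left₀ (norm_nonneg v) hv.le 2
      linarith
    · rw [hsupp v hv, abs_zero]; positivity
  obtain ⟨ψ₀, hcont, hgrowth, hmem, hnorm, horth', hL⟩ := hex g (Cg * (1 + R ^ 2)) hg hb horth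
  refine ⟨ψ₀, hcont, fun v => ?_, hmem, horth', hL⟩
  have hψm : Measurable ψ₀ := hcont.measurable
  have hfix : ∀ v, collisionFrequency v * ψ₀ v =
      (∫ w, ∫ ω, hardSphereKernel (v, w) ω * (ψ₀ (collide ω (v, w)).1 + ψ₀ (collide ω (v, w)).2 - ψ₀ w)
        ∂sphereMeasure ∂stdGaussian (EuclideanSpace ℝ (Fin 3))) - g v := by
    intro v
    have h := hardSphereLinearizedOp_eq_kernel_sub_of_gaussGrowth hψm hgrowth v
    rw [hL v] at h
    linarith
  -- the support-free `L²` bound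
  have hB : (eLpNorm ψ₀ 2 (stdGaussian (EuclideanSpace ℝ (Fin 3)))).toReal ≤ Cg * M4 / lam := by
    rw [le_div_iff₀ hlam, mul_comm]
    exact hnorm.trans (eLpNorm_toReal_le_of_abs_le_quadratic hCg0 hgb)
  have h := hCb ψ₀ g (C₀ * (Cg * (1 + R ^ 2))) (Cg * M4 / lam) Cg hψm hgrowth hmem hB hgb hfix v
  refine h.trans (le_of_eq ?_)
  field_simp

end Summit.AtomisticToContinuum.HydrodynamicLimit.Theorems.ClampedCorrectorBirth
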